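import Literature.Topology.FourManifolds.FlowerDomainPolar
import Literature.Topology.FourManifolds.ThickenedPlanarHandlebody
import HarnessLib

/-!
# Radial monotonicity of the flower and the tip chart of the flower surface

Topic `Literature/Topology/FourManifolds`; fact seat
`provefact-Literature.Topology.FourManifolds.exists-cbed50d78a` (named fact (g′)
`Literature.Topology.FourManifolds.exists_marking_centralSurface_of_gkTrisection`), sequel of
`FlowerHandlebody.lean` / `FlowerDomainPolar.lean` (the flower `q_g`, its axis profile `f`,
`φ`, the radii `r_a < 7^{1/20g} < r_b`, the floor `θ_lo = arccos(min 1 κ)/g`).  Towards the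
marking of the flower surface `Z = {q_g + z² = c_g}` by `S_g` (Hatcher, §1.2 p. 51: a sector of
`Z` deformation retracts onto a wedge of two circles at the lens tip `P = (7^{1/20g}, 0, 0)`, and
`π₁` of a ball with two arcs is free on the two arc loops, `BallWithArcsBasis.lean`), this file
supplies the **ball**: an explicit square chart of `Z` centred at `P`.

* §1 `hasDerivAt_flower_pol`: `∂_r q(pol r θ) = 2r + (f'(r) - 2r) cos(gθ) = r (2 - φ(r) cos(gθ))`.
* §2 **Valley zones** (`cos(gθ) ≤ 0`, e.g. `π/(2g) ≤ θ ≤ 3π/(2g)`): `q` is strictly increasing in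
  `r` (`|φ| ≤ 1` on `[0,1]`, `φ ≥ 0` beyond); and beyond `r_b`, for every angle.
* §3 **Tip zone**: `r_in ∈ (r_a, 7^{1/20g})` with `φ(r_in) = 3` (`FlowerModel.rin`); `φ ≥ 3` on
  `[r_in, 20^{1/20g}]`, so `q` is strictly decreasing in `r` there whenever `cos(gθ) ≥ 3/4`.
* §4 **The floor near the tip**: `κ'(7^{1/20g}) = -f'(7^{1/20g})/V > 0`, whence (continuity) a
  radius `r⋆ ∈ [r_in, 7^{1/20g})` (`FlowerModel.rstar`) with `κ` strictly increasing and
  `3/4 ≤ κ ≤ 1` on `[r⋆, 7^{1/20g}]`; there `θ_lo = arccos(κ)/g` is strictly decreasing and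
  `cos(g θ_lo) = κ`.  The tip data: `r⋆⋆ = (r⋆ + 7^{1/20g})/2`, the angular half-width
  `θ₀ = θ_lo(r⋆⋆) ∈ (0, π/(2g)]` (`cos(gθ) ≥ 3/4` for `|θ| ≤ θ₀`; `θ_lo ≤ θ₀ ↔ r ≥ r⋆⋆` on the tip
  interval; `θ_lo(r⋆) > θ₀`), the outer radius `r₂ = (7^{1/20g} + 20^{1/20g})/2` and the height
  `t₀ = √(c - f(r₂)) > 0`.
* §5 **The tip chart** (`FlowerModel.tipChart : C(closedBall (0 : ℝ × ℝ) 1, ℝ³)`, the closed unit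
  ball of `ℝ × ℝ` being the square `[-1,1]²` in the sup norm): `(x, y) ↦ (pol R (θ₀x), t₀y)` where
  `R = tipR (x, y) ∈ [r⋆, 20^{1/20g}]` solves `q(pol R (θ₀ x)) = c - (t₀ y)²` — it exists by the
  intermediate value theorem (`q > c` at `r⋆` inside the hole, `q ≤ f(20^{1/20g}) < c - t₀²` at the
  outer radius), is unique by §3, and depends continuously on `(x, y)` as a coordinate of the
  inverse of the closed embedding `Λ : (r, θ) ↦ (θ, q(pol r θ))` of the compact parameter box.
  The chart is injective, lands on `Z`, and its range is the **tip patch**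
  `{p ∈ Z : ‖π p‖ ∈ [r⋆, 20^{1/20g}], |arg π p| ≤ θ₀, |p₂| ≤ t₀}` (`FlowerModel.tipPatch`,
  `range_tipChart`), a compact neighbourhood of `P = β(0,0)` in `Z`.

* §6 **Valley coordinates** (for the collars of the valley arcs): on the valley box
  `[0, ρ₄] × [π/(2g), 3π/(2g)]` (where `cos(gθ) ≤ 0`) the map `Λv : (r, θ) ↦ (θ, q(pol r θ))` is a
  closed embedding (§2); its range is `{(θ, v) : 0 ≤ v ≤ q(pol ρ₄ θ)}` (`mem_range_Λv_iff`); the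
  **valley radius** `valleyR (θ, v)` (continuous) inverts it, and the **boundary radius**
  `R(θ) = valleyR (θ, c)` (`FlowerModel.valleyBdry`, continuous, positive, `R(π/g) = ρ₄`) describes
  the flower domain along valley-zone rays: `q(pol r θ) ≤ c ↔ r ≤ R(θ)`.

Everything is proved; no named facts.

## References

* A. Hatcher, *Algebraic Topology*, CUP (2002), §1.2 p. 51 and Example 1.22 p. 43. [HatcherAT2002]
* D. Gay, R. Kirby, *Trisecting 4-manifolds*, Geom. Topol. 20 (2016), Def. 1, Remark 2.
  [GayKirby2016]
-/

open scoped Manifold ContDiff Topology InnerProductSpace Real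
open Set Function Filter Metric Module Complex

noncomputable section

namespace Literature.Topology.FourManifolds

/-- Local notation: `𝔼 n` is the model Euclidean space `EuclideanSpace ℝ (Fin n)`. -/
local notation "𝔼 " n:arg => EuclideanSpace ℝ (Fin n)

open PlanarThickening

namespace FlowerModel

variable {g : ℕ}

/-! ### §1 The radial derivative of the flower -/

/-- `V = prof - r²`. [folklore] -/
theorem V_eq (r : ℝ) : V g r = prof g r - r ^ 2 := by rw [prof_eq]; ring

/-- The radial derivative of `V` is `f'(r) - 2r`. [folklore] -/
theorem hasDerivAt_V (hg : 1 ≤ g) (r : ℝ) : HasDerivAt (V g) (fd g r - 2 * r) r := by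
  have h1 := hasDerivAt_prof hg r
  have h2 : HasDerivAt (fun x : ℝ => x ^ 2) (2 * r) r := by simpa using hasDerivAt_pow 2 r
  have hfun : V g = fun x => prof g x - x ^ 2 := funext V_eq
  rw [hfun]
  exact h1.sub h2

/-- **The radial derivative of the flower**: `∂_r q(pol r θ) = 2r + (f'(r) - 2r) cos(gθ)`. [folklore] -/
theorem hasDerivAt_flower_pol (hg : 1 ≤ g) (θ r : ℝ) :
    HasDerivAt (fun ρ => flower g (pol ρ θ)) (2 * r + (fd g r - 2 * r) * Real.cos (g * θ)) r := by
  have hfun : (fun ρ => flower g (pol ρ θ)) = fun ρ => ρ ^ 2 + V g ρ * Real.cos (g * θ) :=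
    funext fun ρ => flower_pol ρ θ
  rw [hfun]
  have h2 : HasDerivAt (fun x : ℝ => x ^ 2) (2 * r) r := by simpa using hasDerivAt_pow 2 r
  exact h2.add ((hasDerivAt_V hg r).mul_const _)

/-- The radial derivative factored: `2r + (f' - 2r) cos(gθ) = r (2 - φ(r) cos(gθ))` (`g ≥ 2`). [folklore] -/
theorem radial_deriv_eq (hg : 2 ≤ g) (θ r : ℝ) :
    2 * r + (fd g r - 2 * r) * Real.cos (g * θ) = r * (2 - φ g r * Real.cos (g * θ)) := by
  rw [fd_eq hg]; ring

/-- The flower along a ray is continuous in the radius. [folklore] -/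
theorem continuous_flower_pol (hg : 1 ≤ g) (θ : ℝ) : Continuous fun ρ => flower g (pol ρ θ) :=
  continuous_iff_continuousAt.2 fun r => (hasDerivAt_flower_pol hg θ r).continuousAt

/-! ### §2 Valley zones: the flower increases with the radius where `cos(gθ) ≤ 0` -/

/-- `|φ| ≤ 1` on `[0, 1]`: there `φ = r^{g-2}(r^{20g} - 1) E ∈ [-1, 0]`. [folklore] -/
theorem neg_one_le_φ {r : ℝ} (hr0 : 0 ≤ r) (hr1 : r ≤ 1) : -1 ≤ φ g r := by
  rw [φ]
  have hA : r ^ (g - 2) ≤ 1 := pow_le_one₀ hr0 hr1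
  have hA0 : 0 ≤ r ^ (g - 2) := pow_nonneg hr0 _
  have hu : 0 ≤ r ^ (20 * g) := pow_nonneg hr0 _
  have hu1 : r ^ (20 * g) ≤ 1 := pow_le_one₀ hr0 hr1
  have hd := damp_le_one (g := g) (sq_nonneg r)
  have hd0 := (damp_pos (g := g) (r ^ 2)).le
  nlinarith [mul_le_mul hA (by linarith : 1 - r ^ (20 * g) ≤ 1) (by linarith) zero_le_one,
    mul_nonneg (mul_nonneg hA0 (by linarith : 0 ≤ 1 - r ^ (20 * g))) hd0,
    mul_le_mul (le_refl (r ^ (g - 2) * (1 - r ^ (20 * g)))) hd (hd0)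
      (mul_nonneg hA0 (by linarith : 0 ≤ 1 - r ^ (20 * g)))]

/-- `φ ≥ 0` on `[1, ∞)`. [folklore] -/
theorem φ_nonneg {r : ℝ} (hr1 : 1 ≤ r) : 0 ≤ φ g r := by
  rw [φ]
  exact mul_nonneg (mul_nonneg (pow_nonneg (by linarith) _) (sub_nonneg.2 (one_le_pow₀ hr1)))
    (damp_pos _).le

/-- **In a valley zone the radial derivative is positive**: `cos(gθ) ≤ 0` and `r > 0` give
`∂_r q(pol r θ) > 0` (`g ≥ 2`). [folklore] -/
theorem radial_deriv_pos_of_cos_nonpos (hg : 2 ≤ g) {θ r : ℝ} (hr : 0 < r) (hc : Real.cos (g * θ) ≤ 0) :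
    0 < 2 * r + (fd g r - 2 * r) * Real.cos (g * θ) := by
  rw [radial_deriv_eq hg]
  refine mul_pos hr ?_
  rcases le_or_gt r 1 with h1 | h1
  · have hφ := neg_one_le_φ (g := g) hr.le h1
    have hc1 : -1 ≤ Real.cos (g * θ) := Real.neg_one_le_cos _
    nlinarith [mul_nonneg (by linarith : 0 ≤ φ g r + 1) (by linarith : 0 ≤ -Real.cos (g * θ))]
  · have hφ := φ_nonneg (g := g) h1.le
    nlinarith [mul_nonneg hφ (by linarith : 0 ≤ -Real.cos (g * θ))]

/-- **In a valley zone the flower is strictly increasing in the radius** (on `[0, ∞)`). [folklore] -/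
theorem strictMonoOn_flower_pol_of_cos_nonpos (hg : 2 ≤ g) {θ : ℝ} (hc : Real.cos (g * θ) ≤ 0) :
    StrictMonoOn (fun ρ => flower g (pol ρ θ)) (Ici 0) := by
  have hg1 : 1 ≤ g := by omega
  refine strictMonoOn_of_deriv_pos (convex_Ici 0) (continuous_flower_pol hg1 θ).continuousOn
    fun x hx => ?_
  rw [interior_Ici] at hx
  rw [(hasDerivAt_flower_pol hg1 θ x).deriv]
  exact radial_deriv_pos_of_cos_nonpos hg hx hc

/-- Valley zones in angle: for `π/(2g) ≤ θ ≤ 3π/(2g)` one has `cos(gθ) ≤ 0` (`g ≥ 1`). [folklore] -/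
theorem cos_nonpos_of_mem {θ : ℝ} (hg : 1 ≤ g) (h1 : π / (2 * g) ≤ θ) (h2 : θ ≤ 3 * π / (2 * g)) :
    Real.cos (g * θ) ≤ 0 := by
  have hg' : (0 : ℝ) < g := by exact_mod_cast (show 0 < g by omega)
  have h1' : π / 2 ≤ g * θ := by
    rw [div_le_iff₀ (mul_pos two_pos hg')] at h1
    nlinarith
  have h2' : g * θ ≤ π + π / 2 := by
    rw [le_div_iff₀ (mul_pos two_pos hg')] at h2
    nlinarith
  exact Real.cos_nonpos_of_pi_div_two_le_of_le h1' h2'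

/-- **Beyond `r_b` the flower is strictly increasing in the radius**, for every angle. [folklore] -/
theorem strictMonoOn_flower_pol_of_rb (hg : 2 ≤ g) (θ : ℝ) :
    StrictMonoOn (fun ρ => flower g (pol ρ θ)) (Ici (rb hg)) := by
  have hg1 : 1 ≤ g := by omega
  refine strictMonoOn_of_deriv_pos (convex_Ici _) (continuous_flower_pol hg1 θ).continuousOn
    fun x hx => ?_
  rw [interior_Ici] at hx
  rw [(hasDerivAt_flower_pol hg1 θ x).deriv, radial_deriv_eq hg]
  have hx0 : 0 < x := lt_trans (rb_pos hg) hx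
  refine mul_pos hx0 ?_
  have hφ := φ_lt_two_of_rb_lt hg hx
  have hφ0 : 0 ≤ φ g x := φ_nonneg (le_trans (one_le_rt (by norm_num : (1:ℝ) ≤ 22))
    (le_trans (rb_mem hg).1.le hx.le))
  nlinarith [Real.cos_le_one (g * θ), mul_le_mul_of_nonneg_left (Real.cos_le_one (g * θ)) hφ0]

/-! ### §3 The tip zone: the flower decreases with the radius near the lens tip -/

/-- A stronger lower bound at the tip: `φ(7^{1/20g}) > 3`. [folklore] -/
theorem three_lt_φ_rt_seven (hg : 2 ≤ g) : 3 < φ g (rt g 7) := by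
  have hg1 : 1 ≤ g := by omega
  have h7 : (rt g 7) ^ (20 * g) = 7 := rt_pow hg1 (by norm_num)
  have hA : 1 ≤ (rt g 7) ^ (g - 2) := one_le_pow₀ (one_le_rt (by norm_num))
  rw [φ, damp_sq, h7]
  have hE := exp_neg_seven_twentieths
  nlinarith [Real.exp_pos (-(7 / 20 : ℝ))]

/-- `φ(r_a) = 2 < 3 < φ(7^{1/20g})`: there is `r_in ∈ (r_a, 7^{1/20g})` with `φ(r_in) = 3`. [folklore] -/
theorem exists_rin (hg : 2 ≤ g) : ∃ r, r ∈ Ioo (ra hg) (rt g 7) ∧ φ g r = 3 := by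
  have h := intermediate_value_Ioo (ra_lt_rt_seven hg).le continuous_φ.continuousOn (f := φ g)
  have hmem : (3 : ℝ) ∈ Ioo (φ g (ra hg)) (φ g (rt g 7)) := by
    rw [φ_ra hg]; exact ⟨by norm_num, three_lt_φ_rt_seven hg⟩
  obtain ⟨r, hr, hr3⟩ := h hmem
  exact ⟨r, hr, hr3⟩

/-- **The radius `r_in`** with `φ(r_in) = 3`, inside which the tip chart does not reach. [folklore] -/
def rin (hg : 2 ≤ g) : ℝ := Classical.choose (exists_rin hg)

/-- `r_in ∈ (r_a, 7^{1/20g})`. [folklore] -/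
theorem rin_mem (hg : 2 ≤ g) : rin hg ∈ Ioo (ra hg) (rt g 7) := (Classical.choose_spec (exists_rin hg)).1

/-- `φ(r_in) = 3`. [folklore] -/
theorem φ_rin (hg : 2 ≤ g) : φ g (rin hg) = 3 := (Classical.choose_spec (exists_rin hg)).2

/-- `1 < r_in`. [folklore] -/
theorem one_lt_rin (hg : 2 ≤ g) : 1 < rin hg := lt_trans (one_lt_ra hg) (rin_mem hg).1

/-- **`φ ≥ 3` on `[r_in, 20^{1/20g}]`** (`φ` is increasing on `[1, 20^{1/20g}]`). [folklore] -/
theorem three_le_φ (hg : 2 ≤ g) {r : ℝ} (h1 : rin hg ≤ r) (h2 : r ≤ rt g 20) : 3 ≤ φ g r := by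
  have hg1 : 1 ≤ g := by omega
  have hmono := strictMonoOn_φ hg (R := rt g 20) (by rw [rt_pow hg1 (by norm_num)])
  rw [← φ_rin hg]
  exact hmono.monotoneOn ⟨(one_lt_rin hg).le, le_trans h1 h2⟩ ⟨le_trans (one_lt_rin hg).le h1, h2⟩ h1

/-- `7^{1/20g} < 20^{1/20g}`. [folklore] -/
theorem rt_seven_lt_rt_twenty (hg : 1 ≤ g) : rt g 7 < rt g 20 := rt_lt_rt hg (by norm_num) (by norm_num)

/-- `20^{1/20g} < r_b`. [folklore] -/
theorem rt_twenty_lt_rb (hg : 2 ≤ g) : rt g 20 < rb hg :=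
  lt_trans (rt_lt_rt (by omega) (by norm_num) (by norm_num : (20:ℝ) < 22)) (rb_mem hg).1

/-- **In the tip zone the radial derivative is negative**: `r_in ≤ r ≤ 20^{1/20g}` and
`cos(gθ) ≥ 3/4` give `∂_r q(pol r θ) < 0`. [folklore] -/
theorem radial_deriv_neg_of_tip (hg : 2 ≤ g) {θ r : ℝ} (h1 : rin hg ≤ r) (h2 : r ≤ rt g 20)
    (hc : 3 / 4 ≤ Real.cos (g * θ)) : 2 * r + (fd g r - 2 * r) * Real.cos (g * θ) < 0 := by
  rw [radial_deriv_eq hg]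
  have hr : 0 < r := by linarith [one_lt_rin hg]
  have hφ := three_le_φ hg h1 h2
  have : 2 < φ g r * Real.cos (g * θ) := by nlinarith
  exact mul_neg_of_pos_of_neg hr (by linarith)

/-- **In the tip zone the flower is strictly decreasing in the radius** (`cos(gθ) ≥ 3/4`). [folklore] -/
theorem strictAntiOn_flower_pol_of_tip (hg : 2 ≤ g) {θ : ℝ} (hc : 3 / 4 ≤ Real.cos (g * θ)) :
    StrictAntiOn (fun ρ => flower g (pol ρ θ)) (Icc (rin hg) (rt g 20)) := by
  have hg1 : 1 ≤ g := by omega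
  refine strictAntiOn_of_deriv_neg (convex_Icc _ _) (continuous_flower_pol hg1 θ).continuousOn
    fun x hx => ?_
  rw [interior_Icc] at hx
  rw [(hasDerivAt_flower_pol hg1 θ x).deriv]
  exact radial_deriv_neg_of_tip hg hx.1.le hx.2.le hc


/-! ### §4 The floor near the lens tip: `κ` is increasing, `θ_lo` is decreasing -/

/-- `f'` is continuous (`g ≥ 2`). [folklore] -/
theorem continuous_fd (hg : 2 ≤ g) : Continuous (fd g) :=
  continuous_iff_continuousAt.2 fun r => (hasDerivAt_fd hg r).continuousAt

/-- `V` is continuous (`g ≥ 1`). [folklore] -/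
theorem continuous_V (hg : 1 ≤ g) : Continuous (V g) :=
  continuous_iff_continuousAt.2 fun r => (hasDerivAt_V hg r).continuousAt

/-- `f'(7^{1/20g}) < 0`: the tip radius lies between the two critical radii. [folklore] -/
theorem fd_rt_seven_neg (hg : 2 ≤ g) : fd g (rt g 7) < 0 := by
  rw [fd_eq hg]
  exact mul_neg_of_pos_of_neg (rt_pos (by norm_num)) (by linarith [two_lt_φ_rt_seven hg])

/-- `c - (7^{1/20g})² = V(7^{1/20g})` (the tip is a seam point of the axis). [folklore] -/
theorem level_sub_sq_rt_seven : level g - rt g 7 ^ 2 = V g (rt g 7) := by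
  rw [level, V_eq]

/-- The derivative of `κ = (c - r²)/V`. [folklore] -/
def kapD (g : ℕ) (r : ℝ) : ℝ :=
  ((-(2 * r)) * V g r - (level g - r ^ 2) * (fd g r - 2 * r)) / V g r ^ 2

/-- `κ` is differentiable away from the origin, with derivative `kapD`. [folklore] -/
theorem hasDerivAt_kap (hg : 1 ≤ g) {r : ℝ} (hr : 0 < r) : HasDerivAt (kap g) (kapD g r) r := by
  have h1 : HasDerivAt (fun x : ℝ => level g - x ^ 2) (-(2 * r)) r := by
    simpa using (hasDerivAt_pow 2 r).const_sub (level g)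
  have h := h1.div (hasDerivAt_V hg r) (V_pos hg hr).ne'
  exact h

/-- `kapD` is continuous away from the origin. [folklore] -/
theorem continuousOn_kapD (hg : 2 ≤ g) : ContinuousOn (kapD g) (Ioi 0) := by
  have hg1 : 1 ≤ g := by omega
  unfold kapD
  refine ContinuousOn.div (by have := continuous_V hg1; have := continuous_fd hg; fun_prop)
    (by have := continuous_V hg1; fun_prop) fun r hr => ?_
  exact pow_ne_zero 2 (V_pos hg1 hr).ne'

/-- **`κ'(7^{1/20g}) = -f'(7^{1/20g}) / V(7^{1/20g}) > 0`.** [folklore] -/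
theorem kapD_rt_seven_pos (hg : 2 ≤ g) : 0 < kapD g (rt g 7) := by
  have hg1 : 1 ≤ g := by omega
  have hV := V_pos hg1 (rt_pos (g := g) (by norm_num : (0:ℝ) < 7))
  have hfd := fd_rt_seven_neg hg
  rw [kapD, level_sub_sq_rt_seven]
  refine div_pos ?_ (pow_pos hV 2)
  have : -(2 * rt g 7) * V g (rt g 7) - V g (rt g 7) * (fd g (rt g 7) - 2 * rt g 7) =
      V g (rt g 7) * (-fd g (rt g 7)) := by ring
  rw [this]
  exact mul_pos hV (by linarith)

/-- `κ(7^{1/20g}) = 1`. [folklore] -/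
theorem kap_rt_seven (hg : 1 ≤ g) : kap g (rt g 7) = 1 := by
  rw [kap, level_sub_sq_rt_seven, div_self (V_pos hg (rt_pos (by norm_num))).ne']

/-- **The tip interval.**  There is `r⋆ ∈ [r_in, 7^{1/20g})` such that on `[r⋆, 7^{1/20g}]` the
function `κ` is strictly increasing with values in `[3/4, 1]`. [folklore] -/
theorem exists_rstar (hg : 2 ≤ g) : ∃ r, rin hg ≤ r ∧ r < rt g 7 ∧
    StrictMonoOn (kap g) (Icc r (rt g 7)) ∧ ∀ x ∈ Icc r (rt g 7), 3 / 4 ≤ kap g x ∧ kap g x ≤ 1 := by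
  have hg1 : 1 ≤ g := by omega
  set r₁ := rt g 7 with hr₁
  have hr₁0 : 0 < r₁ := rt_pos (by norm_num)
  -- `kapD > 0` and `kap > 3/4` near `r₁`
  have hD : ∀ᶠ x in 𝓝 r₁, 0 < kapD g x :=
    ((continuousOn_kapD hg).continuousAt (Ioi_mem_nhds hr₁0)).eventually (lt_mem_nhds (kapD_rt_seven_pos hg))
  have hK : ∀ᶠ x in 𝓝 r₁, 3 / 4 < kap g x := by
    have hc : ContinuousAt (kap g) r₁ := (hasDerivAt_kap hg1 hr₁0).continuousAt
    exact hc.eventually (lt_mem_nhds (by rw [kap_rt_seven hg1]; norm_num))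
  obtain ⟨ε, hε, hball⟩ := Metric.eventually_nhds_iff.1 (hD.and hK)
  -- the left end point
  set r := max (rin hg) (r₁ - ε / 2) with hr
  have hr_lt : r < r₁ := max_lt (rin_mem hg).2 (by linarith)
  have hrin : rin hg ≤ r := le_max_left _ _
  have hr0 : 0 < r := lt_of_lt_of_le (lt_trans zero_lt_one (one_lt_rin hg)) hrin
  have hclose : ∀ x ∈ Icc r r₁, dist x r₁ < ε := by
    intro x hx
    rw [Real.dist_eq, abs_sub_comm, abs_of_nonneg (by linarith [hx.2])]
    have : r₁ - ε / 2 ≤ x := le_trans (le_max_right _ _) hx.1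
    linarith
  have hmono : StrictMonoOn (kap g) (Icc r r₁) := by
    refine strictMonoOn_of_deriv_pos (convex_Icc _ _) ?_ fun x hx => ?_
    · exact fun x hx => ((hasDerivAt_kap hg1 (lt_of_lt_of_le hr0 hx.1)).continuousAt).continuousWithinAt
    · rw [interior_Icc] at hx
      rw [(hasDerivAt_kap hg1 (lt_trans hr0 hx.1)).deriv]
      exact (hball (hclose x ⟨hx.1.le, hx.2.le⟩)).1
  refine ⟨r, hrin, hr_lt, hmono, fun x hx => ⟨(hball (hclose x hx)).2.le, ?_⟩⟩
  rw [← kap_rt_seven hg1]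
  exact hmono.monotoneOn hx ⟨hr_lt.le, le_rfl⟩ hx.2

/-- **The radius `r⋆`** of `exists_rstar`. [folklore] -/
def rstar (hg : 2 ≤ g) : ℝ := Classical.choose (exists_rstar hg)

/-- `r_in ≤ r⋆`. [folklore] -/
theorem rin_le_rstar (hg : 2 ≤ g) : rin hg ≤ rstar hg := (Classical.choose_spec (exists_rstar hg)).1

/-- `r⋆ < 7^{1/20g}`. [folklore] -/
theorem rstar_lt_rt_seven (hg : 2 ≤ g) : rstar hg < rt g 7 := (Classical.choose_spec (exists_rstar hg)).2.1

/-- `κ` is strictly increasing on `[r⋆, 7^{1/20g}]`. [folklore] -/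
theorem strictMonoOn_kap (hg : 2 ≤ g) : StrictMonoOn (kap g) (Icc (rstar hg) (rt g 7)) :=
  (Classical.choose_spec (exists_rstar hg)).2.2.1

/-- `3/4 ≤ κ ≤ 1` on `[r⋆, 7^{1/20g}]`. [folklore] -/
theorem kap_mem_of_mem (hg : 2 ≤ g) {x : ℝ} (hx : x ∈ Icc (rstar hg) (rt g 7)) :
    3 / 4 ≤ kap g x ∧ kap g x ≤ 1 :=
  (Classical.choose_spec (exists_rstar hg)).2.2.2 x hx

/-- `1 < r⋆`. [folklore] -/
theorem one_lt_rstar (hg : 2 ≤ g) : 1 < rstar hg := lt_of_lt_of_le (one_lt_rin hg) (rin_le_rstar hg)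

/-- `0 < r⋆`. [folklore] -/
theorem rstar_pos (hg : 2 ≤ g) : 0 < rstar hg := lt_trans zero_lt_one (one_lt_rstar hg)

/-- On `[r⋆, 7^{1/20g}]` the floor is `θ_lo = arccos(κ)/g`. [folklore] -/
theorem thlo_eq_arccos_kap (hg : 2 ≤ g) {x : ℝ} (hx : x ∈ Icc (rstar hg) (rt g 7)) :
    thlo g x = Real.arccos (kap g x) / g := by
  rw [thlo_eq hg (lt_of_lt_of_le (rstar_pos hg) hx.1), min_eq_right (kap_mem_of_mem hg hx).2]

/-- **`θ_lo` is strictly decreasing on `[r⋆, 7^{1/20g}]`.** [folklore] -/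
theorem strictAntiOn_thlo (hg : 2 ≤ g) : StrictAntiOn (thlo g) (Icc (rstar hg) (rt g 7)) := by
  intro x hx y hy hxy
  have hg' : (0 : ℝ) < g := by exact_mod_cast (show 0 < g by omega)
  rw [thlo_eq_arccos_kap hg hx, thlo_eq_arccos_kap hg hy]
  refine div_lt_div_of_pos_right ?_ hg'
  have hkx := kap_mem_of_mem hg hx
  have hky := kap_mem_of_mem hg hy
  exact Real.strictAntiOn_arccos ⟨by linarith [hkx.1], hkx.2⟩ ⟨by linarith [hky.1], hky.2⟩
    (strictMonoOn_kap hg hx hy hxy)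

/-- **`cos(g θ_lo) = κ ≥ 3/4` on `[r⋆, 7^{1/20g}]`.** [folklore] -/
theorem cos_mul_thlo (hg : 2 ≤ g) {x : ℝ} (hx : x ∈ Icc (rstar hg) (rt g 7)) :
    Real.cos (g * thlo g x) = kap g x := by
  have hg' : (g : ℝ) ≠ 0 := by exact_mod_cast (show g ≠ 0 by omega)
  have hk := kap_mem_of_mem hg hx
  rw [thlo_eq_arccos_kap hg hx, mul_div_cancel₀ _ hg', Real.cos_arccos (by linarith [hk.1]) hk.2]

/-- **The tip data.**  `r⋆⋆ = (r⋆ + 7^{1/20g})/2`, the angular half-width `θ₀ = θ_lo(r⋆⋆)` of the tip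
chart, the outer radius `r₂ = (7^{1/20g} + 20^{1/20g})/2` and the height `t₀ = √(c - f(r₂))` of the
tip chart. [folklore] -/
def rss (hg : 2 ≤ g) : ℝ := (rstar hg + rt g 7) / 2

/-- The angular half-width of the tip chart. [folklore] -/
def θ₀ (hg : 2 ≤ g) : ℝ := thlo g (rss hg)

/-- The outer spine radius of the tip chart. [folklore] -/
def rtwo (g : ℕ) : ℝ := (rt g 7 + rt g 20) / 2

/-- The height of the tip chart. [folklore] -/
def t₀ (g : ℕ) : ℝ := Real.sqrt (level g - prof g (rtwo g))

/-- `r⋆ < r⋆⋆ < 7^{1/20g}`. [folklore] -/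
theorem rss_mem (hg : 2 ≤ g) : rss hg ∈ Ioo (rstar hg) (rt g 7) := by
  have := rstar_lt_rt_seven hg
  constructor <;> rw [rss] <;> linarith

/-- `r⋆⋆ ∈ [r⋆, 7^{1/20g}]`. [folklore] -/
theorem rss_mem_Icc (hg : 2 ≤ g) : rss hg ∈ Icc (rstar hg) (rt g 7) := Ioo_subset_Icc_self (rss_mem hg)

/-- `ρ₁ < r⋆`. [folklore] -/
theorem rho1_lt_rstar (hg : 2 ≤ g) : rho1 hg < rstar hg :=
  lt_trans (rho1_mem hg).2 (lt_of_lt_of_le (rin_mem hg).1 (rin_le_rstar hg))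

/-- `0 < θ₀`: `r⋆⋆` lies strictly inside the lens range `(ρ₁, 7^{1/20g})`. [folklore] -/
theorem θ₀_pos (hg : 2 ≤ g) : 0 < θ₀ hg :=
  thlo_pos_of_mem_lens hg (lt_trans (rho1_lt_rstar hg) (rss_mem hg).1) (rss_mem hg).2

/-- `θ₀ ≤ π/(2g)` (indeed `g θ₀ = arccos κ(r⋆⋆) ≤ arccos (3/4)`). [folklore] -/
theorem θ₀_le (hg : 2 ≤ g) : θ₀ hg ≤ π / (2 * g) := by
  have hg' : (0 : ℝ) < g := by exact_mod_cast (show 0 < g by omega)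
  rw [θ₀, thlo_eq_arccos_kap hg (rss_mem_Icc hg), div_le_div_iff₀ hg' (mul_pos two_pos hg')]
  have hk := kap_mem_of_mem hg (rss_mem_Icc hg)
  have : Real.arccos (kap g (rss hg)) ≤ π / 2 := Real.arccos_le_pi_div_two.2 (by linarith [hk.1])
  nlinarith [Real.pi_pos]

/-- `θ₀ < π`. [folklore] -/
theorem θ₀_lt_pi (hg : 2 ≤ g) : θ₀ hg < π := by
  have hg' : (2 : ℝ) ≤ g := by exact_mod_cast hg
  calc θ₀ hg ≤ π / (2 * g) := θ₀_le hg
    _ ≤ π / (2 * 2) := div_le_div_of_nonneg_left Real.pi_pos.le (by norm_num) (by nlinarith)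
    _ < π := by linarith [Real.pi_pos]

/-- **`cos(gθ) ≥ 3/4` for `|θ| ≤ θ₀`.** [folklore] -/
theorem cos_ge_of_abs_le_θ₀ (hg : 2 ≤ g) {θ : ℝ} (hθ : |θ| ≤ θ₀ hg) : 3 / 4 ≤ Real.cos (g * θ) := by
  have hg' : (0 : ℝ) < g := by exact_mod_cast (show 0 < g by omega)
  have hk := kap_mem_of_mem hg (rss_mem_Icc hg)
  have hcos0 : Real.cos (g * θ₀ hg) = kap g (rss hg) := cos_mul_thlo hg (rss_mem_Icc hg)
  -- `cos (g θ) = cos (g |θ|) ≥ cos (g θ₀)` as `0 ≤ g|θ| ≤ g θ₀ ≤ π`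
  have h1 : Real.cos (g * θ) = Real.cos (g * |θ|) := by
    rcases abs_choice θ with h | h
    · rw [h]
    · rw [h, mul_neg, Real.cos_neg]
  rw [h1]
  have hle : g * |θ| ≤ g * θ₀ hg := mul_le_mul_of_nonneg_left hθ hg'.le
  have hpi : g * θ₀ hg ≤ π := by
    have := θ₀_le hg
    rw [le_div_iff₀ (mul_pos two_pos hg')] at this
    nlinarith [Real.pi_pos]
  have := Real.cos_le_cos_of_nonneg_of_le_pi (mul_nonneg hg'.le (abs_nonneg θ)) hpi hle
  linarith [hk.1]

/-- On `[r⋆, 7^{1/20g}]`: `θ_lo(r) ≤ θ₀ ↔ r⋆⋆ ≤ r`. [folklore] -/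
theorem thlo_le_θ₀_iff (hg : 2 ≤ g) {r : ℝ} (hr : r ∈ Icc (rstar hg) (rt g 7)) :
    thlo g r ≤ θ₀ hg ↔ rss hg ≤ r := by
  rw [θ₀]
  constructor
  · intro hle
    by_contra hlt
    push Not at hlt
    exact absurd hle (not_le.2 (strictAntiOn_thlo hg hr (rss_mem_Icc hg) hlt))
  · intro hle
    exact (strictAntiOn_thlo hg).antitoneOn (rss_mem_Icc hg) hr hle

/-- `θ_lo(r⋆) > θ₀`. [folklore] -/
theorem θ₀_lt_thlo_rstar (hg : 2 ≤ g) : θ₀ hg < thlo g (rstar hg) :=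
  strictAntiOn_thlo hg ⟨le_rfl, (rstar_lt_rt_seven hg).le⟩ (rss_mem_Icc hg) (rss_mem hg).1

/-- `7^{1/20g} < r₂ < 20^{1/20g}`. [folklore] -/
theorem rtwo_mem (hg : 1 ≤ g) : rtwo g ∈ Ioo (rt g 7) (rt g 20) := by
  have := rt_seven_lt_rt_twenty hg
  constructor <;> rw [rtwo] <;> linarith

/-- `f(r₂) < c` (`r₂` lies in `(7^{1/20g}, r_b)` where `f < c`). [folklore] -/
theorem prof_rtwo_lt_level (hg : 2 ≤ g) : prof g (rtwo g) < level g := by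
  have hg1 : 1 ≤ g := by omega
  have h1 := (rtwo_mem hg1).1
  have h2 : rtwo g < rb hg := lt_trans (rtwo_mem hg1).2 (rt_twenty_lt_rb hg)
  have hanti := strictAntiOn_prof hg
  have := hanti ⟨(ra_lt_rt_seven hg).le, (rt_seven_lt_rb hg).le⟩ ⟨le_trans (ra_lt_rt_seven hg).le h1.le, h2.le⟩ h1
  rw [level]; exact this

/-- `0 < t₀`. [folklore] -/
theorem t₀_pos (hg : 2 ≤ g) : 0 < t₀ g := Real.sqrt_pos.2 (by linarith [prof_rtwo_lt_level hg])

/-- `t₀² = c - f(r₂)`. [folklore] -/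
theorem t₀_sq (hg : 2 ≤ g) : t₀ g ^ 2 = level g - prof g (rtwo g) :=
  Real.sq_sqrt (by linarith [prof_rtwo_lt_level hg])


/-! ### §5 The tip chart: a square in the flower surface around the lens tip `P` -/

/-- `r⋆ ≤ ρ₄`. [folklore] -/
theorem rstar_le_rho4 (hg : 2 ≤ g) : rstar hg ≤ rho4 hg :=
  le_of_lt (lt_trans (rstar_lt_rt_seven hg) (rt_seven_lt_rho4 hg))

/-- `θ₀ ≤ π/g`. [folklore] -/
theorem θ₀_le_pi_div (hg : 2 ≤ g) : θ₀ hg ≤ π / g := by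
  have hg' : (0 : ℝ) < g := by exact_mod_cast (show 0 < g by omega)
  calc θ₀ hg ≤ π / (2 * g) := θ₀_le hg
    _ ≤ π / g := div_le_div_of_nonneg_left Real.pi_pos.le hg' (by linarith)

/-- At radius `r⋆` the tip cone lies in the hole: `q(pol r⋆ θ) > c` for `|θ| ≤ θ₀`. [folklore] -/
theorem level_lt_flower_pol_rstar (hg : 2 ≤ g) {θ : ℝ} (hθ : |θ| ≤ θ₀ hg) :
    level g < flower g (pol (rstar hg) θ) := by
  by_contra hle
  push Not at hle
  have h := (flower_pol_le_level_iff_abs hg (rstar_pos hg) (rstar_le_rho4 hg)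
    (le_trans hθ (θ₀_le_pi_div hg))).1 hle
  linarith [θ₀_lt_thlo_rstar hg]

/-- At radius `20^{1/20g}` the flower is below `c - t₀²`. [folklore] -/
theorem flower_pol_rt_twenty_lt (hg : 2 ≤ g) (θ : ℝ) :
    flower g (pol (rt g 20) θ) < level g - t₀ g ^ 2 := by
  have hg1 : 1 ≤ g := by omega
  have h1 : flower g (pol (rt g 20) θ) ≤ prof g (rt g 20) := flower_pol_le_prof (rt_pos (by norm_num)).le θ
  have h2 : prof g (rt g 20) < prof g (rtwo g) := by
    have hanti := strictAntiOn_prof hg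
    refine hanti ⟨le_trans (ra_lt_rt_seven hg).le (rtwo_mem hg1).1.le, ?_⟩
      ⟨le_trans (ra_lt_rt_seven hg).le (rt_seven_lt_rt_twenty hg1).le, (rt_twenty_lt_rb hg).le⟩
      (rtwo_mem hg1).2
    exact le_trans (rtwo_mem hg1).2.le (rt_twenty_lt_rb hg).le
  rw [t₀_sq hg]; linarith

/-- **Existence of the radius**: for `|θ| ≤ θ₀` and `|t| ≤ t₀` there is `r ∈ (r⋆, 20^{1/20g})` with
`q(pol r θ) = c - t²`. [folklore] -/
theorem exists_radius (hg : 2 ≤ g) {θ t : ℝ} (hθ : |θ| ≤ θ₀ hg) (ht : |t| ≤ t₀ g) :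
    ∃ r ∈ Ioo (rstar hg) (rt g 20), flower g (pol r θ) = level g - t ^ 2 := by
  have hg1 : 1 ≤ g := by omega
  have hab : rstar hg ≤ rt g 20 := le_of_lt (lt_trans (rstar_lt_rt_seven hg) (rt_seven_lt_rt_twenty hg1))
  have h := intermediate_value_Ioo' hab (continuous_flower_pol hg1 θ).continuousOn
  have ht2 : t ^ 2 ≤ t₀ g ^ 2 := by
    rw [← sq_abs t]; exact pow_le_pow_left₀ (abs_nonneg t) ht 2
  have hmem : level g - t ^ 2 ∈ Ioo (flower g (pol (rt g 20) θ)) (flower g (pol (rstar hg) θ)) :=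
    ⟨by linarith [flower_pol_rt_twenty_lt hg θ], by linarith [level_lt_flower_pol_rstar hg hθ, sq_nonneg t]⟩
  obtain ⟨r, hr, hq⟩ := h hmem
  exact ⟨r, hr, hq⟩

/-- **Uniqueness of the radius** on `[r⋆, 20^{1/20g}]` (`|θ| ≤ θ₀`). [folklore] -/
theorem radius_unique (hg : 2 ≤ g) {θ : ℝ} (hθ : |θ| ≤ θ₀ hg) {r r' : ℝ}
    (hr : r ∈ Icc (rstar hg) (rt g 20)) (hr' : r' ∈ Icc (rstar hg) (rt g 20))
    (h : flower g (pol r θ) = flower g (pol r' θ)) : r = r' :=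
  (strictAntiOn_flower_pol_of_tip hg (cos_ge_of_abs_le_θ₀ hg hθ)).injOn
    ⟨le_trans (rin_le_rstar hg) hr.1, hr.2⟩ ⟨le_trans (rin_le_rstar hg) hr'.1, hr'.2⟩ h

/-- **The parameter box** `[r⋆, 20^{1/20g}] × [-θ₀, θ₀]` of the tip chart. [folklore] -/
def tipBox (hg : 2 ≤ g) : Set (ℝ × ℝ) := Icc (rstar hg) (rt g 20) ×ˢ Icc (-θ₀ hg) (θ₀ hg)

/-- The parameter box is compact. [folklore] -/
theorem isCompact_tipBox (hg : 2 ≤ g) : IsCompact (tipBox hg) := isCompact_Icc.prod isCompact_Icc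

/-- The parameter box is a compact space. [folklore] -/
instance (hg : 2 ≤ g) : CompactSpace (tipBox hg) := isCompact_iff_compactSpace.1 (isCompact_tipBox hg)

/-- The map `(r, θ) ↦ (θ, q(pol r θ))` on the parameter box. [folklore] -/
def Λ (hg : 2 ≤ g) (x : tipBox hg) : ℝ × ℝ := (x.1.2, flower g (pol x.1.1 x.1.2))

/-- `Λ` is continuous. [folklore] -/
theorem continuous_Λ (hg : 2 ≤ g) : Continuous (Λ hg) := by
  unfold Λ
  refine (continuous_snd.comp continuous_subtype_val).prodMk ?_
  exact contDiff_flower.continuous.comp (continuous_pol.comp continuous_subtype_val)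

/-- `|θ| ≤ θ₀` on the box. [folklore] -/
theorem abs_le_of_mem_tipBox (hg : 2 ≤ g) {x : ℝ × ℝ} (hx : x ∈ tipBox hg) : |x.2| ≤ θ₀ hg :=
  abs_le.2 ⟨hx.2.1, hx.2.2⟩

/-- `Λ` is injective (radial monotonicity in the tip zone). [folklore] -/
theorem injective_Λ (hg : 2 ≤ g) : Injective (Λ hg) := by
  rintro ⟨⟨r, θ⟩, hx⟩ ⟨⟨r', θ'⟩, hx'⟩ h
  simp only [Λ, Prod.mk.injEq] at h
  obtain ⟨hθ, hq⟩ := h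
  subst hθ
  have := radius_unique hg (abs_le_of_mem_tipBox hg hx) hx.1 hx'.1 hq
  subst this
  rfl

/-- `Λ` is a closed embedding. [folklore] -/
theorem isClosedEmbedding_Λ (hg : 2 ≤ g) : Topology.IsClosedEmbedding (Λ hg) :=
  (continuous_Λ hg).isClosedEmbedding (injective_Λ hg)

/-- The homeomorphism of the box onto the image of `Λ`. [folklore] -/
def eΛ (hg : 2 ≤ g) : tipBox hg ≃ₜ range (Λ hg) := (isClosedEmbedding_Λ hg).toIsEmbedding.toHomeomorph

/-- `Λ ∘ eΛ⁻¹ = id` on the range. [folklore] -/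
theorem Λ_eΛ_symm (hg : 2 ≤ g) (w : range (Λ hg)) : Λ hg ((eΛ hg).symm w) = w := by
  obtain ⟨_, x, rfl⟩ := w
  rw [eΛ, Topology.IsEmbedding.toHomeomorph_symm_apply]

/-- Points of the closed unit ball of `ℝ × ℝ` (sup norm) have both coordinates in `[-1, 1]`.
[folklore] -/
theorem abs_le_one_of_mem_closedBall {z : ℝ × ℝ} (hz : z ∈ closedBall (0 : ℝ × ℝ) 1) :
    |z.1| ≤ 1 ∧ |z.2| ≤ 1 := by
  rw [mem_closedBall, dist_zero_right, Prod.norm_def, max_le_iff, Real.norm_eq_abs, Real.norm_eq_abs] at hz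
  exact hz

/-- `(x, y) ∈` closed unit ball iff `|x|, |y| ≤ 1`. [folklore] -/
theorem mem_closedBall_iff_abs {z : ℝ × ℝ} : z ∈ closedBall (0 : ℝ × ℝ) 1 ↔ |z.1| ≤ 1 ∧ |z.2| ≤ 1 := by
  rw [mem_closedBall, dist_zero_right, Prod.norm_def, max_le_iff, Real.norm_eq_abs, Real.norm_eq_abs]

/-- `|θ₀ x| ≤ θ₀` for `|x| ≤ 1`. [folklore] -/
theorem abs_θ₀_mul_le (hg : 2 ≤ g) {x : ℝ} (hx : |x| ≤ 1) : |θ₀ hg * x| ≤ θ₀ hg := by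
  rw [abs_mul, abs_of_pos (θ₀_pos hg)]
  exact mul_le_of_le_one_right (θ₀_pos hg).le hx

/-- `|t₀ y| ≤ t₀` for `|y| ≤ 1`. [folklore] -/
theorem abs_t₀_mul_le (hg : 2 ≤ g) {y : ℝ} (hy : |y| ≤ 1) : |t₀ g * y| ≤ t₀ g := by
  rw [abs_mul, abs_of_pos (t₀_pos hg)]
  exact mul_le_of_le_one_right (t₀_pos hg).le hy

/-- The target point `(θ₀ x, c - (t₀ y)²)` of the tip chart lies in the image of `Λ`. [folklore] -/
theorem tipTarget_mem (hg : 2 ≤ g) {z : ℝ × ℝ} (hz : z ∈ closedBall (0 : ℝ × ℝ) 1) :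
    (θ₀ hg * z.1, level g - (t₀ g * z.2) ^ 2) ∈ range (Λ hg) := by
  obtain ⟨h1, h2⟩ := abs_le_one_of_mem_closedBall hz
  have hθ := abs_θ₀_mul_le hg h1
  obtain ⟨r, hr, hq⟩ := exists_radius hg hθ (abs_t₀_mul_le hg h2)
  exact ⟨⟨(r, θ₀ hg * z.1), ⟨Ioo_subset_Icc_self hr, abs_le.1 hθ⟩⟩, by simp [Λ, hq]⟩

/-- **The radius function of the tip chart**: the radius `r ∈ [r⋆, 20^{1/20g}]` of the point of the
flower surface with angle `θ₀ x` and height `t₀ y` (continuous, as a coordinate of the inverse of the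
embedding `Λ`). [folklore] -/
def tipR (hg : 2 ≤ g) (z : closedBall (0 : ℝ × ℝ) 1) : ℝ :=
  ((eΛ hg).symm ⟨_, tipTarget_mem hg z.2⟩).1.1

/-- The radius function is continuous. [folklore] -/
theorem continuous_tipR (hg : 2 ≤ g) : Continuous (tipR hg) := by
  unfold tipR
  refine (continuous_fst.comp continuous_subtype_val).comp ((eΛ hg).symm.continuous.comp ?_)
  refine Continuous.subtype_mk ?_ _
  fun_prop

/-- **Defining property of the radius function.** [folklore] -/
theorem tipR_spec (hg : 2 ≤ g) (z : closedBall (0 : ℝ × ℝ) 1) :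
    tipR hg z ∈ Icc (rstar hg) (rt g 20) ∧
      flower g (pol (tipR hg z) (θ₀ hg * z.1.1)) = level g - (t₀ g * z.1.2) ^ 2 := by
  set w : range (Λ hg) := ⟨_, tipTarget_mem hg z.2⟩ with hw
  have h := Λ_eΛ_symm hg w
  set x := (eΛ hg).symm w with hx
  have hθ : x.1.2 = θ₀ hg * z.1.1 := by
    have := congrArg Prod.fst h
    simpa [Λ] using this
  have hq : flower g (pol x.1.1 x.1.2) = level g - (t₀ g * z.1.2) ^ 2 := by
    have := congrArg Prod.snd h
    simpa [Λ] using this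
  refine ⟨x.2.1, ?_⟩
  show flower g (pol x.1.1 (θ₀ hg * z.1.1)) = _
  rw [← hθ]; exact hq

/-- `0 < tipR`. [folklore] -/
theorem tipR_pos (hg : 2 ≤ g) (z : closedBall (0 : ℝ × ℝ) 1) : 0 < tipR hg z :=
  lt_of_lt_of_le (rstar_pos hg) (tipR_spec hg z).1.1

/-- **The tip chart** `β : [-1, 1]² → Z`, `(x, y) ↦ (pol (tipR (x,y)) (θ₀ x), t₀ y)`. [folklore] -/
def tipChart (hg : 2 ≤ g) : C(closedBall (0 : ℝ × ℝ) 1, 𝔼 3) where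
  toFun z := lift (pol (tipR hg z) (θ₀ hg * z.1.1)) + (t₀ g * z.1.2) • ez
  continuous_toFun := by
    refine (lift.continuous.comp ?_).add ((continuous_const.mul
      (continuous_snd.comp continuous_subtype_val)).smul continuous_const)
    show Continuous ((fun x : ℝ × ℝ => pol x.1 x.2) ∘ fun z : closedBall (0 : ℝ × ℝ) 1 =>
      (tipR hg z, θ₀ hg * z.1.1))
    exact continuous_pol.comp ((continuous_tipR hg).prodMk (continuous_const.mul
      (continuous_fst.comp continuous_subtype_val)))

/-- The tip chart, evaluated. [folklore] -/
theorem tipChart_apply (hg : 2 ≤ g) (z : closedBall (0 : ℝ × ℝ) 1) :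
    tipChart hg z = lift (pol (tipR hg z) (θ₀ hg * z.1.1)) + (t₀ g * z.1.2) • ez := rfl

/-- The projection of the tip chart. [folklore] -/
theorem proj_tipChart (hg : 2 ≤ g) (z : closedBall (0 : ℝ × ℝ) 1) :
    proj (tipChart hg z) = pol (tipR hg z) (θ₀ hg * z.1.1) := by
  rw [tipChart_apply, map_add, map_smul, proj_lift, proj_ez, smul_zero, add_zero]

/-- The height of the tip chart. [folklore] -/
theorem tipChart_apply_two (hg : 2 ≤ g) (z : closedBall (0 : ℝ × ℝ) 1) :
    tipChart hg z 2 = t₀ g * z.1.2 := by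
  rw [tipChart_apply]; simp

/-- **The tip chart lands on the flower surface.** [folklore] -/
theorem thicken_tipChart (hg : 2 ≤ g) (z : closedBall (0 : ℝ × ℝ) 1) :
    thicken (flower g) (tipChart hg z) = level g := by
  rw [thicken_apply, proj_tipChart, tipChart_apply_two, (tipR_spec hg z).2]; ring

/-- The norm of the projection of the tip chart is the radius function. [folklore] -/
theorem norm_proj_tipChart (hg : 2 ≤ g) (z : closedBall (0 : ℝ × ℝ) 1) :
    ‖proj (tipChart hg z)‖ = tipR hg z := by
  rw [proj_tipChart, norm_pol, abs_of_pos (tipR_pos hg z)]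

/-- `θ₀ x ∈ (-π, π]` for `|x| ≤ 1`. [folklore] -/
theorem θ₀_mul_mem_Ioc (hg : 2 ≤ g) {x : ℝ} (hx : |x| ≤ 1) : θ₀ hg * x ∈ Ioc (-π) π := by
  have h := abs_le.1 (abs_θ₀_mul_le hg hx)
  have := θ₀_lt_pi hg
  exact ⟨by linarith [h.1], by linarith [h.2]⟩

/-- The angle of the projection of the tip chart. [folklore] -/
theorem arg_proj_tipChart (hg : 2 ≤ g) (z : closedBall (0 : ℝ × ℝ) 1) :
    Complex.arg (toC (proj (tipChart hg z))) = θ₀ hg * z.1.1 := by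
  rw [proj_tipChart]
  exact arg_toC_pol (tipR_pos hg z) (θ₀_mul_mem_Ioc hg (abs_le_one_of_mem_closedBall z.2).1)

/-- **The tip chart is injective.** [folklore] -/
theorem injective_tipChart (hg : 2 ≤ g) : Injective (tipChart hg) := by
  intro z z' h
  have h1 : z.1.1 = z'.1.1 := by
    have := congrArg (fun p => Complex.arg (toC (proj p))) h
    simp only [arg_proj_tipChart] at this
    exact mul_left_cancel₀ (θ₀_pos hg).ne' this
  have h2 : z.1.2 = z'.1.2 := by
    have := congrArg (fun p : 𝔼 3 => p 2) h
    simp only [tipChart_apply_two] at this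
    exact mul_left_cancel₀ (t₀_pos hg).ne' this
  exact Subtype.ext (Prod.ext h1 h2)

variable (g) in
/-- **The tip patch** `B`: the points of the flower surface with `‖π p‖ ∈ [r⋆, 20^{1/20g}]`,
`|arg π p| ≤ θ₀` and `|p₂| ≤ t₀`. [folklore] -/
def tipPatch (hg : 2 ≤ g) : Set (𝔼 3) :=
  {p | thicken (flower g) p = level g ∧ ‖proj p‖ ∈ Icc (rstar hg) (rt g 20) ∧
    |Complex.arg (toC (proj p))| ≤ θ₀ hg ∧ |p 2| ≤ t₀ g}

/-- **The range of the tip chart is the tip patch.** [folklore] -/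
theorem range_tipChart (hg : 2 ≤ g) : range (tipChart hg) = tipPatch g hg := by
  apply Subset.antisymm
  · rintro p ⟨z, rfl⟩
    obtain ⟨h1, h2⟩ := abs_le_one_of_mem_closedBall z.2
    refine ⟨thicken_tipChart hg z, ?_, ?_, ?_⟩
    · rw [norm_proj_tipChart]; exact (tipR_spec hg z).1
    · rw [arg_proj_tipChart]; exact abs_θ₀_mul_le hg h1
    · rw [tipChart_apply_two]; exact abs_t₀_mul_le hg h2
  · rintro p ⟨hq, hR, hθ, ht⟩
    set R := ‖proj p‖ with hRdef
    set θ := Complex.arg (toC (proj p)) with hθdef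
    set t := p 2 with htdef
    have hR0 : 0 < R := lt_of_lt_of_le (rstar_pos hg) hR.1
    -- `proj p = pol R θ`
    have hpol : proj p = pol R θ := by
      obtain ⟨θ', hθ', h'⟩ := exists_eq_pol (proj p)
      have : θ = θ' := by rw [hθdef, h', arg_toC_pol hR0 hθ']
      rw [this]; exact h'
    -- the parameters
    have hx : |θ / θ₀ hg| ≤ 1 := by
      rw [abs_div, abs_of_pos (θ₀_pos hg), div_le_one (θ₀_pos hg)]; exact hθ
    have hy : |t / t₀ g| ≤ 1 := by
      rw [abs_div, abs_of_pos (t₀_pos hg), div_le_one (t₀_pos hg)]; exact ht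
    set z : closedBall (0 : ℝ × ℝ) 1 := ⟨(θ / θ₀ hg, t / t₀ g), mem_closedBall_iff_abs.2 ⟨hx, hy⟩⟩ with hz
    refine ⟨z, ?_⟩
    have hzx : θ₀ hg * z.1.1 = θ := mul_div_cancel₀ _ (θ₀_pos hg).ne'
    have hzy : t₀ g * z.1.2 = t := mul_div_cancel₀ _ (t₀_pos hg).ne'
    -- the radius of `p` solves the same equation as `tipR z`
    have hqR : flower g (pol R θ) = level g - t ^ 2 := by
      have h := hq
      rw [thicken, hpol] at h
      linarith
    have hspec := tipR_spec hg z
    rw [hzx, hzy] at hspec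
    have hRR : tipR hg z = R := radius_unique hg hθ hspec.1 hR (by rw [hspec.2, hqR])
    rw [tipChart_apply, hzx, hzy, hRR, ← hpol, htdef, lift_proj_add]

/-- The tip patch is compact. [folklore] -/
theorem isCompact_tipPatch (hg : 2 ≤ g) : IsCompact (tipPatch g hg) := by
  rw [← range_tipChart hg]
  haveI : CompactSpace (closedBall (0 : ℝ × ℝ) 1) := isCompact_iff_compactSpace.1 (isCompact_closedBall 0 1)
  exact isCompact_range (tipChart hg).continuous

/-- **The lens tip** `P = (7^{1/20g}, 0, 0)` is the centre `β(0, 0)` of the tip chart. [folklore] -/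
def ptP (g : ℕ) : 𝔼 3 := lift (ax (rt g 7))

/-- `P` lies on the flower surface. [folklore] -/
theorem thicken_ptP (g : ℕ) : thicken (flower g) (ptP g) = level g := by
  rw [ptP, thicken_lift, flower_ax', level]

/-- `P` lies in the tip patch. [folklore] -/
theorem ptP_mem_tipPatch (hg : 2 ≤ g) : ptP g ∈ tipPatch g hg := by
  have hg1 : 1 ≤ g := by omega
  refine ⟨thicken_ptP g, ?_, ?_, ?_⟩
  · rw [ptP, proj_lift, norm_ax, abs_of_pos (rt_pos (by norm_num))]
    exact ⟨(rstar_lt_rt_seven hg).le, (rt_seven_lt_rt_twenty hg1).le⟩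
  · rw [ptP, proj_lift, ← pol_zero_right, arg_toC_pol (rt_pos (by norm_num)) ⟨by linarith [Real.pi_pos],
      Real.pi_pos.le⟩, abs_zero]
    exact (θ₀_pos hg).le
  · rw [ptP, lift_apply_two, abs_zero]; exact (t₀_pos hg).le


/-! ### §6 Valley coordinates: `(r, θ) ↦ (θ, q)` on the valley zone -/

/-- **The valley box** `[0, ρ₄] × [π/(2g), 3π/(2g)]`: radii and angles of the valley zone around
the valley ray `θ = π/g` (where `cos(gθ) ≤ 0`). [folklore] -/
def valleyBox (hg : 2 ≤ g) : Set (ℝ × ℝ) := Icc 0 (rho4 hg) ×ˢ Icc (π / (2 * g)) (3 * π / (2 * g))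

/-- The valley box is compact. [folklore] -/
theorem isCompact_valleyBox (hg : 2 ≤ g) : IsCompact (valleyBox hg) := isCompact_Icc.prod isCompact_Icc

/-- The valley box is a compact space. [folklore] -/
instance instCompactSpaceValleyBox (hg : 2 ≤ g) : CompactSpace (valleyBox hg) :=
  isCompact_iff_compactSpace.1 (isCompact_valleyBox hg)

/-- In the valley box `cos(gθ) ≤ 0`. [folklore] -/
theorem cos_nonpos_of_mem_valleyBox (hg : 2 ≤ g) {x : ℝ × ℝ} (hx : x ∈ valleyBox hg) :
    Real.cos (g * x.2) ≤ 0 :=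
  cos_nonpos_of_mem (by omega) hx.2.1 hx.2.2

/-- The valley coordinates `(r, θ) ↦ (θ, q(pol r θ))`. [folklore] -/
def Λv (hg : 2 ≤ g) (x : valleyBox hg) : ℝ × ℝ := (x.1.2, flower g (pol x.1.1 x.1.2))

/-- `Λv` is continuous. [folklore] -/
theorem continuous_Λv (hg : 2 ≤ g) : Continuous (Λv hg) := by
  unfold Λv
  refine (continuous_snd.comp continuous_subtype_val).prodMk ?_
  exact contDiff_flower.continuous.comp (continuous_pol.comp continuous_subtype_val)

/-- `Λv` is injective (radial monotonicity in the valley zone). [folklore] -/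
theorem injective_Λv (hg : 2 ≤ g) : Injective (Λv hg) := by
  rintro ⟨⟨r, θ⟩, hx⟩ ⟨⟨r', θ'⟩, hx'⟩ h
  simp only [Λv, Prod.mk.injEq] at h
  obtain ⟨hθ, hq⟩ := h
  subst hθ
  have hmono := strictMonoOn_flower_pol_of_cos_nonpos hg (cos_nonpos_of_mem_valleyBox hg hx)
  have := hmono.injOn (hx.1.1 : (0 : ℝ) ≤ r) (hx'.1.1 : (0 : ℝ) ≤ r') hq
  subst this
  rfl

/-- `Λv` is a closed embedding. [folklore] -/
theorem isClosedEmbedding_Λv (hg : 2 ≤ g) : Topology.IsClosedEmbedding (Λv hg) :=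
  (continuous_Λv hg).isClosedEmbedding (injective_Λv hg)

/-- The homeomorphism of the valley box onto the image of `Λv`. [folklore] -/
def eΛv (hg : 2 ≤ g) : valleyBox hg ≃ₜ range (Λv hg) := (isClosedEmbedding_Λv hg).toIsEmbedding.toHomeomorph

/-- `Λv ∘ eΛv⁻¹ = id` on the range. [folklore] -/
theorem Λv_eΛv_symm (hg : 2 ≤ g) (w : range (Λv hg)) : Λv hg ((eΛv hg).symm w) = w := by
  obtain ⟨_, x, rfl⟩ := w
  rw [eΛv, Topology.IsEmbedding.toHomeomorph_symm_apply]

/-- `eΛv⁻¹ ∘ Λv = id`. [folklore] -/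
theorem eΛv_symm_apply_mk (hg : 2 ≤ g) (x : valleyBox hg) :
    (eΛv hg).symm ⟨Λv hg x, mem_range_self x⟩ = x := by
  apply injective_Λv hg
  rw [Λv_eΛv_symm]

/-- At radius `ρ₄` the flower is at least `c` (everywhere: `q ≥ vprof` and `vprof(ρ₄) = c`). [folklore] -/
theorem level_le_flower_pol_rho4 (hg : 2 ≤ g) (θ : ℝ) : level g ≤ flower g (pol (rho4 hg) θ) := by
  rw [← vprof_rho4 hg]; exact vprof_le_flower_pol (rho4_pos hg).le θ

/-- **The range of the valley coordinates**: `(θ, v)` with `θ` in the valley zone and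
`0 ≤ v ≤ q(pol ρ₄ θ)`. [folklore] -/
theorem mem_range_Λv_iff (hg : 2 ≤ g) {θ v : ℝ} :
    (θ, v) ∈ range (Λv hg) ↔ θ ∈ Icc (π / (2 * g)) (3 * π / (2 * g)) ∧ 0 ≤ v ∧ v ≤ flower g (pol (rho4 hg) θ) := by
  have hg1 : 1 ≤ g := by omega
  constructor
  · rintro ⟨⟨⟨r, θ'⟩, hx⟩, h⟩
    simp only [Λv, Prod.mk.injEq] at h
    obtain ⟨rfl, rfl⟩ := h
    have hmono := (strictMonoOn_flower_pol_of_cos_nonpos hg (cos_nonpos_of_mem_valleyBox hg hx)).monotoneOn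
    refine ⟨hx.2, ?_, ?_⟩
    · have h0 := hmono (self_mem_Ici : (0:ℝ) ∈ Ici 0) (hx.1.1 : (0:ℝ) ≤ r) hx.1.1
      simp only [pol_zero_left, flower_zero hg1] at h0
      exact h0
    · exact hmono (hx.1.1 : (0:ℝ) ≤ r) (rho4_pos hg).le hx.1.2
  · rintro ⟨hθ, h0, h1⟩
    -- intermediate value theorem on `[0, ρ₄]`
    have hcont := (continuous_flower_pol hg1 θ).continuousOn (s := Icc 0 (rho4 hg))
    have hivt := intermediate_value_Icc (rho4_pos hg).le hcont
    have hmem : v ∈ Icc (flower g (pol 0 θ)) (flower g (pol (rho4 hg) θ)) := by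
      rw [pol_zero_left, flower_zero hg1]; exact ⟨h0, h1⟩
    obtain ⟨r, hr, hq⟩ := hivt hmem
    exact ⟨⟨(r, θ), ⟨hr, hθ⟩⟩, by simp [Λv, hq]⟩

/-- **The valley radius function**: the radius of the point of the valley zone with angle `θ` and
flower value `v`, continuous on the range of the valley coordinates. [folklore] -/
def valleyR (hg : 2 ≤ g) (w : range (Λv hg)) : ℝ := ((eΛv hg).symm w).1.1

/-- The valley radius function is continuous. [folklore] -/
theorem continuous_valleyR (hg : 2 ≤ g) : Continuous (valleyR hg) :=
  (continuous_fst.comp continuous_subtype_val).comp (eΛv hg).symm.continuous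

/-- **Defining property of the valley radius.** [folklore] -/
theorem valleyR_spec (hg : 2 ≤ g) (w : range (Λv hg)) :
    valleyR hg w ∈ Icc 0 (rho4 hg) ∧ flower g (pol (valleyR hg w) w.1.1) = w.1.2 := by
  have h := Λv_eΛv_symm hg w
  set x := (eΛv hg).symm w with hx
  have hθ : x.1.2 = w.1.1 := by
    have := congrArg Prod.fst h; simpa [Λv] using this
  have hq : flower g (pol x.1.1 x.1.2) = w.1.2 := by
    have := congrArg Prod.snd h; simpa [Λv] using this
  exact ⟨x.2.1, by rw [← hθ]; exact hq⟩

/-- **Uniqueness of the valley radius.** [folklore] -/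
theorem valleyR_unique (hg : 2 ≤ g) (w : range (Λv hg)) {r : ℝ} (hr : 0 ≤ r)
    (h : flower g (pol r w.1.1) = w.1.2) : r = valleyR hg w := by
  have hθ : w.1.1 ∈ Icc (π / (2 * g)) (3 * π / (2 * g)) := by
    obtain ⟨⟨x, hx⟩, hw⟩ := w.2
    have : x.2 = w.1.1 := by have := congrArg Prod.fst hw; simpa [Λv] using this
    rw [← this]; exact hx.2
  have hmono := strictMonoOn_flower_pol_of_cos_nonpos hg (cos_nonpos_of_mem (by omega) hθ.1 hθ.2)
  have hspec := valleyR_spec hg w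
  exact hmono.injOn (hr : r ∈ Ici (0:ℝ)) (hspec.1.1 : valleyR hg w ∈ Ici (0:ℝ)) (h.trans hspec.2.symm)

/-- The valley radius of the coordinates of a box point is its radius. [folklore] -/
theorem valleyR_Λv (hg : 2 ≤ g) (x : valleyBox hg) : valleyR hg ⟨Λv hg x, mem_range_self x⟩ = x.1.1 := by
  rw [valleyR, eΛv_symm_apply_mk]

/-- **The boundary radius** `R(θ)` of the flower domain along a valley-zone ray: `q(pol R θ) = c`.
[folklore] -/
def valleyBdry (hg : 2 ≤ g) (θ : Icc (π / (2 * g)) (3 * π / (2 * (g : ℝ)))) : ℝ :=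
  valleyR hg ⟨(θ.1, level g), (mem_range_Λv_iff hg).2 ⟨θ.2, (level_pos (by omega)).le,
    level_le_flower_pol_rho4 hg θ.1⟩⟩

/-- The boundary radius is continuous in the angle. [folklore] -/
theorem continuous_valleyBdry (hg : 2 ≤ g) : Continuous (valleyBdry hg) := by
  unfold valleyBdry
  refine (continuous_valleyR hg).comp (Continuous.subtype_mk ?_ _)
  fun_prop

/-- **Defining property of the boundary radius.** [folklore] -/
theorem valleyBdry_spec (hg : 2 ≤ g) (θ : Icc (π / (2 * g)) (3 * π / (2 * (g : ℝ)))) :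
    valleyBdry hg θ ∈ Icc 0 (rho4 hg) ∧ flower g (pol (valleyBdry hg θ) θ.1) = level g :=
  valleyR_spec hg _

/-- The boundary radius is positive. [folklore] -/
theorem valleyBdry_pos (hg : 2 ≤ g) (θ : Icc (π / (2 * g)) (3 * π / (2 * (g : ℝ)))) : 0 < valleyBdry hg θ := by
  have h := valleyBdry_spec hg θ
  rcases h.1.1.eq_or_lt with h0 | h0
  · exfalso
    have := h.2
    rw [← h0, pol_zero_left, flower_zero (by omega)] at this
    exact (level_pos (by omega)).ne this
  · exact h0

/-- **The flower domain along a valley-zone ray** is the segment `[0, R(θ)]`. [folklore] -/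
theorem flower_pol_le_level_iff_valley (hg : 2 ≤ g) (θ : Icc (π / (2 * g)) (3 * π / (2 * (g : ℝ))))
    {r : ℝ} (hr : 0 ≤ r) : flower g (pol r θ.1) ≤ level g ↔ r ≤ valleyBdry hg θ := by
  have hmono := strictMonoOn_flower_pol_of_cos_nonpos hg (cos_nonpos_of_mem (by omega) θ.2.1 θ.2.2)
  rw [← (valleyBdry_spec hg θ).2]
  exact hmono.le_iff_le hr (valleyBdry_pos hg θ).le

/-- On the valley ray itself the boundary radius is `ρ₄`. [folklore] -/
theorem valleyBdry_valley (hg : 2 ≤ g) (h : π / g ∈ Icc (π / (2 * g)) (3 * π / (2 * (g : ℝ)))) :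
    valleyBdry hg ⟨π / g, h⟩ = rho4 hg := by
  symm
  refine valleyR_unique hg _ (rho4_pos hg).le ?_
  show flower g (pol (rho4 hg) (π / g)) = level g
  rw [flower_pol_valley (by omega), vprof_rho4 hg]

/-- The valley angle lies in the valley zone. [folklore] -/
theorem valley_mem_Icc (hg : 1 ≤ g) : π / g ∈ Icc (π / (2 * g)) (3 * π / (2 * (g : ℝ))) := by
  have hg' : (0 : ℝ) < g := by exact_mod_cast (show 0 < g by omega)
  constructor
  · rw [div_le_div_iff₀ (mul_pos two_pos hg') hg']; nlinarith [Real.pi_pos]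
  · rw [div_le_div_iff₀ hg' (mul_pos two_pos hg')]; nlinarith [Real.pi_pos]

end FlowerModel

end Literature.Topology.FourManifolds
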